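/-
Copyright (c) 2026 the pub-hodgecm-mathlib formalisation cell (harness21).  Prover seat hodgecm-mathlib-K2E3-p01 (g0), Track B ∕ K2-LIT
(build stream 29), h413 = `stmt-HodgeConjecture-24833`, line `K2_E3_EllipticInputs`, socket module «U3CubicGerms» U3-b, file #2 — the payment of
`K2E3EllipticInputs.U3CubicGerms.sig_K2E3ShalikaGermExpansionDyadic` TOKEN FOR TOKEN, plus the `hexp` glue of `cubicGermResidue_of_sigs`
(refuter K2E3-r01 (g0) «B1 FINDING 0», K2/STATUS.md 2026-09-03T21:52:24Z: both are ★ in the tree).  2026-09-03.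
-/
import Literature.NumberTheory.Rogawski1990.ShalikaGermExpansionUnitaryThreeNonsplitCM   -- ★ `UnitaryGroup.shalikaGermExpansionNonsplit_antidiagOne_three` (Prop. 8.1.1 at EVERY non-split place, ED. 2∕3)
import Literature.NumberTheory.Rogawski1990.CMLocalAPacketMembers                      -- ★ `Rogawski1990.qsForm` (the socket's name for `Φ₃`)
import Literature.NumberTheory.Automorphic.UnitaryGroupNonsplitPlace                    -- ★ `PlacesOver.subsingleton_of_smul_eq`
import Literature.NumberTheory.Automorphic.QuadraticLocalBaseChange                     -- ★ `PlacesOver.nonempty`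
import HarnessLib

/-!
# h413 ∕ Track B «K2-LIT», line `K2_E3_EllipticInputs`, socket module «U3CubicGerms» U3-b: SHALIKA'S GERM EXPANSION ON `U(Φ₃)(L⁺_v)`, `v` NON-SPLIT (DYADIC INCLUDED)
# (payment of `Cruxes/H413/Lines/K2_E3_EllipticInputsSigs_U3CubicGerms.lean :: sig_K2E3ShalikaGermExpansionDyadic`, statement bytes frozen; + the `hexp` glue)

Cell `pub/hodgecm-mathlib`, crux H413 = `stmt-HodgeConjecture-24833`, route of record `HCCMUnconditional`; chair K2-lead (g0), dealer K2E3-plan.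
SIGS-TABLE-K2E3 row #2 `sig_K2E3ShalikaGermExpansionDyadic` was typed «XL, junction OWNER Track A LH4 (`stub_ShDyadic`), p02 HELD»; refuter K2E3-r01 (g0)'s
B1 FINDING 0 (K2/STATUS.md 21:52:24Z, probe `K2/K2E3-r01/g0/Probe_ShalikaAllNonsplit.K2E3-r01-g0.lean` rc 0) observed that the tree ALREADY proves Shalika's germ
expansion for `U(Φ₃)(L⁺_v)` at EVERY non-split place with NO parity hypothesis — ★ `UnitaryGroup.shalikaGermExpansionNonsplit_antidiagOne_three`
(`ShalikaGermExpansionUnitaryThreeNonsplitCM.lean` §4, ED. 2; in-house end to end: ‹U-FIN› p850231, ‹RAO› p850226, ‹SPAN›, ‹DUAL› p850291, the SH-3 plug) — so the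
«dyadic» socket and the composition's hypothesis `hexp` («the expansion at every non-split `v`») are both re-ties BY NAME.  This file is that re-tie (E3 side,
«E3 re-ties by import when it lands», REQUESTS l.72411); THEOREMS ONLY (no `def`, no `instance`, no `notation`, no named-fact hypothesis, no `sorry`);
imports = ★ Literature + HarnessLib (never `Cruxes/…/Lines`); lane `--supports stmt-HodgeConjecture-24833 --as helper`.

THE STATEMENTS.
* §1 `shalikaGermExpansionNonsplit_of_nonsplit` — EXACTLY the binder `hexp` of `U3CubicGerms.cubicGermResidue_of_sigs`:
  `∀ L v, (∀ w : PlacesOver L v, c • w.1 = w.1) → ShalikaGermExpansionNonsplit L (qsForm L) v` (a place `w ∣ v` exists, ★ `PlacesOver.nonempty`; all places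
  above `v` being `c`-fixed makes the fibre a singleton, ★ `PlacesOver.subsingleton_of_smul_eq`; then ★ §4).
* §2 **`ShalikaGermExpansionDyadic`** — socket #2 TOKEN FOR TOKEN (the Lines-side reducible `abbrev Pl L := HeightOneSpectrum (𝓞 L⁺)` inlined):
  `∀ L v (w : PlacesOver L v), Subsingleton (PlacesOver L v) → v_w(2) < 1 → ShalikaGermExpansionNonsplit L (qsForm L) v` — ★ §4 at `w`; the dyadic hypothesis
  `Valued.v 2 < 1` is NOT used (the ★ proof is residue-characteristic free).  Tie probe at home (socket module built on stream 29):
  `example : type_of% @ShalikaGermExpansionDyadic = type_of% @K2E3EllipticInputs.U3CubicGerms.sig_K2E3ShalikaGermExpansionDyadic := rfl`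
  (file `K2/K2E3-p01/g0/Probe_K2E3ShalikaGermExpansionDyadic.lean`).

CONSEQUENCE FOR THE UNIT (not asserted here — the composition lives in the Lines module): with ★ p854975 `K2E3CubicTorusTypeThreeExists.CubicTorusTypeThreeExists`
(row #1) and this file, `cubicGermResidue_of_sigs shalikaGermExpansionNonsplit_of_nonsplit CubicTorusTypeThreeExists ‹row #3›` shows the tier-0 stub
`stub_cubicGermResidue` ⟸ ROW #3 `sig_K2E3GermResidueAtCubicTorus` ALONE (r01's `cubicGermResidue_of_row3`).

WHAT IS NOT HERE.  Any new mathematics: Prop. 8.1.1 itself is ★ (`ShalikaGermExpansionUnitaryThreeNonsplitCM`, 2026-09-02); the germ RESIDUE along the cubic torus (row #3,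
`sig_K2E3GermResidueAtCubicTorus`, the unit's remaining XL file).
HONEST LABEL.  HC_CM is proved only modulo the 7 printed citations (2 remaining named inputs: hLiu418 = `stmt-HodgeConjecture-24832`, h413 =
`stmt-HodgeConjecture-24833`) until rung 0 closes; this file pays one socket and one glue hypothesis of the K2E3 skeleton by ★ re-use and proves no printed letter by itself.

## References
* [Rogawski1990] J. D. Rogawski, *Automorphic Representations of Unitary Groups in Three Variables*, Ann. of Math. Stud. 123 (1990), §8.1 Prop. 8.1.1 pp. 112–113
  (germ expansion `Φ(γδ, f) = Σ_u Γ_u(δ, μ_δ, γ) Φ(u, f)`, any p-adic `F`, no parity proviso).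
* [HarishChandra1999AdmissibleDistributions] Harish-Chandra, *Admissible Invariant Distributions on Reductive p-adic Groups*, ULS 16 (1999), Thm. 8.1 p. 48 (germs).
* [CasselsFrohlichANT1967] J. W. S. Cassels, A. Fröhlich (eds.), *Algebraic Number Theory* (1967), Ch. VII Prop. 1.2 (ii) (one place above a non-split place).
-/

set_option autoImplicit false
-- the mandated namespace repeats the single-problem summit's segment (`HodgeConjecture.HodgeConjecture`), as in every `Theorems/*.lean` of this sub-problem
set_option linter.dupNamespace false

noncomputable section

open NumberField IsDedekindDomain
open Literature.NumberTheory.Rogawski1990 Literature.NumberTheory.Automorphic Literature.NumberTheory.Automorphic.UnitaryGroup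

namespace Summit.HodgeConjecture.HodgeConjecture.Cruxes.H413.K2E3ShalikaGermExpansionDyadic

/-! ## §1 The `hexp` glue: Shalika's germ expansion for `U(Φ₃)(L⁺_v)` at EVERY non-split `v` -/

/-- **Shalika's germ expansion on `U(Φ₃)(L⁺_v)` at every finite place `v` of `L⁺` that does not split in `L`** — EXACTLY the hypothesis `hexp` of
`U3CubicGerms.cubicGermResidue_of_sigs`: if every place `w ∣ v` of `L` is fixed by complex conjugation then ★ `ShalikaGermExpansionNonsplit L Φ₃ v`
([Rogawski1990] Prop. 8.1.1: `Φ(γδ, f) = Σ_u Γ_u(δ, μ_δ, γ) Φ(u, f)` for `δ` regular near `1`).  Proof: a place `w ∣ v` exists (★ `PlacesOver.nonempty`),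
the fibre is a singleton (★ `PlacesOver.subsingleton_of_smul_eq`, [CasselsFrohlichANT1967] VII Prop. 1.2 (ii)), and ★
`UnitaryGroup.shalikaGermExpansionNonsplit_antidiagOne_three` (no parity hypothesis) concludes.
[cite: Rogawski1990, §8.1 Prop. 8.1.1 pp. 112–113] [cite: HarishChandra1999AdmissibleDistributions, Thm. 8.1 p. 48] -/
theorem shalikaGermExpansionNonsplit_of_nonsplit :
    ∀ (L : Type) [Field L] [NumberField L] [IsCMField L] (v : HeightOneSpectrum (𝓞 ↥(maximalRealSubfield L))),
      (∀ w : PlacesOver L v, IsCMField.complexConj L • w.1 = w.1) → ShalikaGermExpansionNonsplit L (qsForm L) v := by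
  intro L _ _ _ v hns
  obtain ⟨w⟩ := PlacesOver.nonempty L v
  exact UnitaryGroup.shalikaGermExpansionNonsplit_antidiagOne_three L v w
    (PlacesOver.subsingleton_of_smul_eq (IsCMField.complexConj L) (IsCMField.complexConj_ne_one L) w (hns w))

/-! ## §2 The socket `sig_K2E3ShalikaGermExpansionDyadic`, token for token -/

/-- **FILE `K2E3ShalikaGermExpansionDyadic` — SHALIKA'S GERM EXPANSION AT THE IDENTITY ON `U(Φ₃)(L⁺_v)`, `v` NON-SPLIT AND DYADIC**
(`K2E3EllipticInputs.U3CubicGerms.sig_K2E3ShalikaGermExpansionDyadic` TOKEN FOR TOKEN, the Lines-side `abbrev Pl L` inlined).  For a CM field `L`, a finite place `v` of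
`L⁺` with a single place `w` of `L` above it, and `v_w(2) < 1`: ★ `ShalikaGermExpansionNonsplit L Φ₃ v` ([Rogawski1990] Prop. 8.1.1).  Proof: ★
`UnitaryGroup.shalikaGermExpansionNonsplit_antidiagOne_three L v w hsub` — the tree's proof of Prop. 8.1.1 for `U(Φ₃)` (‹U-FIN›, ‹RAO›, ‹SPAN›, ‹DUAL› at every
non-split place, Howe∕Harish-Chandra plug) carries NO restriction on the residue characteristic, so the dyadic hypothesis is idle (kept: statement bytes frozen).
[cite: Rogawski1990, §8.1 Prop. 8.1.1 p. 112] [cite: HarishChandra1999AdmissibleDistributions, Thm. 8.1 p. 48] -/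
theorem ShalikaGermExpansionDyadic :
  ∀ (L : Type) [Field L] [NumberField L] [IsCMField L] (v : HeightOneSpectrum (𝓞 ↥(maximalRealSubfield L))) (w : PlacesOver L v),
    Subsingleton (PlacesOver L v) → Valued.v (2 : w.1.adicCompletion L) < 1 →
    ShalikaGermExpansionNonsplit L (qsForm L) v :=
  fun L _ _ _ v w hsub _ => UnitaryGroup.shalikaGermExpansionNonsplit_antidiagOne_three L v w hsub

end Summit.HodgeConjecture.HodgeConjecture.Cruxes.H413.K2E3ShalikaGermExpansionDyadic

end
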